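import Summits.QuantumFields.YangMills.Theorems.FluctuationComparisonRegPrIntLS2BetaLaplaceLimitOn
import HarnessLib

/-!
# S2β · LAPLACE row — LIMIT-INST: the S2β INSTANTIATION of the LIMIT door at a window datum (pen w5-20520 g13, LINE OWNER WORDs 10–11)

Cell `ym3-torus` (rung R3: continuum `SU(2)` Yang–Mills on `T³` — NOT `d = 4`, NOT infinite volume, NOT a mass gap, NOT Clay); width seat `ym-ust-20520-w5` g13;
helper of the crux `stmt-QuantumFields-20520` (`--supports`, NOT a proof of it).  THEOREMS ONLY (0 `def`, 0 `sorry` when filed; default heartbeats).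

WHAT.  (T) = CHART∞ ∘ LIMIT ∘ KNIT ∘ DECAY (LINE g18-1 `Lines/semiclassical_s2beta.lean`, LAPLACE row).  The door ✓`…S2BetaLaplaceLimitOn.laplaceLimit_corner_on'`
(w4-20520 g15) is abstract in the carrier; THIS FILE fixes the carrier of record (β″): `X₀ := SU(2)^{bonds_K}` with product Haar `ν_K`, the group
`Kg := ↥S × (PBond (F.P K) (K−J) → SU(2))` (`S` = the residual gauge subgroup, px11 g9's `residualSubgroup F hJK`, displayed here as any compact subgroup) acting by
the PIVOT-BLIND action `act (w, h) z := extend βₙ (c ↦ h c · z (βₙ c)) (w • z)` (px11's `pivotAct`, LEFT convention), the model `A₀ := wilsonAction4 ∘ Φ_V`,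
`a₀ := jac_V`, `O₀ := Φ_V⁻¹ S_fine` read on a WREG window chart `c` (✓F3 `WindowChart`), `hmodel` := ✓KNIT `heightDensityCan_mul_exp_eq_integral` — and feeds the door
ONE TERM PER ROW from the displayed CHART∞ rows (w3-20520 g13: continuity of `Φ_V`, `jac_V` on a compact invariant pivot-blind set `Xc`, vanishing off it, equivariance),
the displayed tubular-chart rows ((C3β″), px21 g9: `e, σ, W, J, ρ`), the EXW ∕ GAP♯ rows of the line and ONE displayed Peano row (the transversal Hessian; seam GAP 2).
OUTPUT = the KNIT's per-corner hypothesis: `∃ ℓ > 0, λ^{dV∕2} · (heightDensityCan F (γ∕λ) hJK S_fine V · e^{λ β_K m}) → ℓ`.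

HONEST SCOPE.  An instantiation; every analytic input is a displayed hypothesis supplied by the named pens; nothing of CHART∞ ∕ (C3) ∕ DECAY ∕ LAPLACE ∕ S2β ∕ the
crux 20520 is proved here; `YM3TorusSU2` NOT proved; the Yang–Mills mass gap (Clay) NOT proved.

References: [Balaban1985UV3] CMP 102 (1985) (2) p. 256, (41) p. 266; [Balaban1985Variational] CMP 102 (1985) Thm 1 (8)–(10) p. 279, (142) p. 299;
[HasenpflugRudolfSprungk2024] Ann. Appl. Probab. 34 (2024) §3.1, §3.4; [Breitung1994] LNM 1592 Thm 41 p. 56.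
-/

noncomputable section

open MeasureTheory MeasureTheory.Measure Filter Topology Set Module Metric Function
open scoped Real InnerProductSpace ENNReal NNReal Pointwise
open Literature.MathematicalPhysics.QuantumFieldTheory.Balaban1983to89
open Literature.MathematicalPhysics.QuantumFieldTheory.Balaban1983to89.T3ContinuumYM3Torus
open Literature.MathematicalPhysics.QuantumFieldTheory.Balaban1983to89.T3UnitLawDensityEML
open scoped Literature.MathematicalPhysics.QuantumFieldTheory.Balaban1983to89.T3OrbitAverage
open Summit.QuantumFields.YangMills.Theorems.FluctuationComparisonRegPrIntLWregGlue
open Summit.QuantumFields.YangMills.Theorems.FluctuationComparisonRegPrIntLS2BetaLaplaceKnit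
open Summit.QuantumFields.YangMills.Theorems.FluctuationComparisonRegPrIntLS2BetaLaplaceLimit
open Summit.QuantumFields.YangMills.Theorems.FluctuationComparisonRegPrIntLS2BetaLaplaceLimitOn
open Literature.Analysis.Asymptotics

namespace Summit.QuantumFields.YangMills.Theorems.FluctuationComparisonRegPrIntLS2BetaLaplaceInst

/-! ## §1 The instantiation at one corner -/

/-- ★★★ **LIMIT-INST — THE SCALED LAPLACE LIMIT OF THE CANONICAL DENSITY AT A WINDOW DATUM, ON THE CARRIER OF RECORD (β″).**  Data: a WREG window chart
`c` on `O ∋ V` for the fine event `Sf`; a compact subgroup `S` of the fine gauge group (the residual group) and a Haar measure `ν` on `Kg := ↥S × (pivots → SU(2))`;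
the pivot-blind action `act`; CHART∞ rows (compact `act`-invariant `Xc ⊆ SU(2)^{bonds}` carrying the continuity of `z ↦ wilsonAction4 (c.Φ (V,z))`, of
`z ↦ c.jac (V,z)` and of the growth function, `c.jac (V,·) = 0` off `Xc`, invariances, relative openness of the event); (C3β″) rows (`e, σ, W, J, ρ` with the chart
identity for `ν_K`, `σ` landing in `Xc`, the slice rows `hstab ∕ hfix`); EXW rows (`c.Φ (V, σ 0)` minimises with value `m`); GAP♯ rows (growth `g`); the Peano row
(`Ah`); positivity rows for the constant.  Conclusion: the KNIT's hypothesis at the corner `V` with exponent `dV∕2`.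
[cite: Balaban1985UV3, (2) p. 256 and (41) p. 266] [cite: Balaban1985Variational, Thm 1 (8)-(10) p. 279 and (142) p. 299]
[cite: HasenpflugRudolfSprungk2024, §3.1 Assumption 3 (M)(T) and §3.4] [cite: Breitung1994, Thm 41 p. 56] -/
theorem laplaceLimit_of_charts
    (F : T3Family) {γ : ℝ} (hγ : 0 < γ) {J K : ℕ} (hJK : J ≤ K)
    {Sf : Set (GaugeField (F.P K) 0 (Matrix.specialUnitaryGroup (Fin 2) ℂ))} (hSf : MeasurableSet Sf)
    {O : Set (GaugeField (F.P J) 0 (Matrix.specialUnitaryGroup (Fin 2) ℂ))} (hO : IsOpen O)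
    (c : WindowChart F hJK Sf O) {V : GaugeField (F.P J) 0 (Matrix.specialUnitaryGroup (Fin 2) ℂ)} (hV : V ∈ O) (m : ℝ)
    -- the group of record: a compact subgroup `S` (the residual gauge group) × the pivot translations, with a Haar measure
    (S : Subgroup (Site (F.P K) 0 → Matrix.specialUnitaryGroup (Fin 2) ℂ)) (hS : CompactSpace S)
    (ν : Measure (S × (PBond (F.P K) (K - J) → Matrix.specialUnitaryGroup (Fin 2) ℂ))) [ν.IsHaarMeasure]
    -- the action of `Kg` on the fine fields (of record: px11's pivot-blind `pivotAct F hJK (iterCentralBond (K−J))`; only its four rows are used)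
    (act : S × (PBond (F.P K) (K - J) → Matrix.specialUnitaryGroup (Fin 2) ℂ) →
      GaugeField (F.P K) 0 (Matrix.specialUnitaryGroup (Fin 2) ℂ) → GaugeField (F.P K) 0 (Matrix.specialUnitaryGroup (Fin 2) ℂ))
    (hact : Continuous fun p : (S × (PBond (F.P K) (K - J) → Matrix.specialUnitaryGroup (Fin 2) ℂ)) ×
      GaugeField (F.P K) 0 (Matrix.specialUnitaryGroup (Fin 2) ℂ) => act p.1 p.2)
    (hmul : ∀ k k' z, act (k * k') z = act k (act k' z)) (hone : ∀ z, act 1 z = z)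
    (hpres : ∀ k, MeasurePreserving (act k) (fieldMeasure (F.P K) 0 (Matrix.specialUnitaryGroup (Fin 2) ℂ))
      (fieldMeasure (F.P K) 0 (Matrix.specialUnitaryGroup (Fin 2) ℂ)))
    -- CHART∞ rows at `V` (w3-20520 g13): the compact invariant pivot-blind set carrying continuity, vanishing off it, invariances, relative openness
    {Xc : Set (GaugeField (F.P K) 0 (Matrix.specialUnitaryGroup (Fin 2) ℂ))} (hXc : IsCompact Xc) (hXinv : ∀ k z, z ∈ Xc → act k z ∈ Xc)
    (hvan : ∀ z, z ∉ Xc → (c.jac (V, z) : ℝ) = 0)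
    (hA : ContinuousOn (fun z => wilsonAction4 (c.Φ (V, z))) Xc) (ha : ContinuousOn (fun z => (c.jac (V, z) : ℝ)) Xc)
    (hAinv : ∀ k, ∀ z ∈ Xc, wilsonAction4 (c.Φ (V, act k z)) = wilsonAction4 (c.Φ (V, z)))
    (hainv : ∀ k, ∀ z ∈ Xc, (c.jac (V, act k z) : ℝ) = c.jac (V, z))
    (hOrel : IsOpen ((Subtype.val : Xc → GaugeField (F.P K) 0 (Matrix.specialUnitaryGroup (Fin 2) ℂ)) ⁻¹' {z | c.Φ (V, z) ∈ Sf}))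
    (hOinv : ∀ k, ∀ z ∈ Xc, c.Φ (V, z) ∈ Sf → c.Φ (V, act k z) ∈ Sf)
    -- (C3β″) rows (px21 g9): tubular Haar coordinates around the `act`-orbit of the minimiser, the transversal landing in `Xc`, the slice
    {dZ dV : ℕ} (e : EuclideanSpace ℝ (Fin dZ) → S × (PBond (F.P K) (K - J) → Matrix.specialUnitaryGroup (Fin 2) ℂ))
    (σ : EuclideanSpace ℝ (Fin dV) → GaugeField (F.P K) 0 (Matrix.specialUnitaryGroup (Fin 2) ℂ))
    (he : Continuous e) (he1 : e 0 = 1) (he𝓝 : 𝓝 (1 : S × (PBond (F.P K) (K - J) → Matrix.specialUnitaryGroup (Fin 2) ℂ)) ≤ map e (𝓝 0))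
    (hσ : Continuous σ) (hσX : ∀ y, σ y ∈ Xc)
    (hΘ'𝓝 : 𝓝 (σ 0) ≤ map (fun p : EuclideanSpace ℝ (Fin dZ) × EuclideanSpace ℝ (Fin dV) => act (e p.1) (σ p.2)) (𝓝 0))
    {W : Set (EuclideanSpace ℝ (Fin dZ) × EuclideanSpace ℝ (Fin dV))} (hWo : IsOpen W)
    (hinj : InjOn (fun p : EuclideanSpace ℝ (Fin dZ) × EuclideanSpace ℝ (Fin dV) => act (e p.1) (σ p.2)) W)
    {Jd : EuclideanSpace ℝ (Fin dZ) × EuclideanSpace ℝ (Fin dV) → ℝ} (hJc : ContinuousOn Jd W) (hJ0 : ∀ w ∈ W, 0 ≤ Jd w)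
    (hchart : (fieldMeasure (F.P K) 0 (Matrix.specialUnitaryGroup (Fin 2) ℂ)).restrict
        ((fun p : EuclideanSpace ℝ (Fin dZ) × EuclideanSpace ℝ (Fin dV) => act (e p.1) (σ p.2)) '' W) =
      ((((volume : Measure (EuclideanSpace ℝ (Fin dZ))).prod (volume : Measure (EuclideanSpace ℝ (Fin dV)))).restrict W).withDensity
          fun w => ENNReal.ofReal (Jd w)).map (fun p : EuclideanSpace ℝ (Fin dZ) × EuclideanSpace ℝ (Fin dV) => act (e p.1) (σ p.2)))
    {ρ : ℝ} (hρ : 0 < ρ) (hρW : closedBall (0 : EuclideanSpace ℝ (Fin dZ)) ρ ×ˢ {(0 : EuclideanSpace ℝ (Fin dV))} ⊆ W)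
    (hJ00 : 0 < ∫ z in ball (0 : EuclideanSpace ℝ (Fin dZ)) ρ, Jd (z, 0))
    {Sst : Set (S × (PBond (F.P K) (K - J) → Matrix.specialUnitaryGroup (Fin 2) ℂ))}
    (hstab : ∀ k, act k (σ 0) = σ 0 → k ∈ Sst) (hfix : ∀ s ∈ Sst, ∀ y, act s (σ y) = σ y)
    -- EXW rows at `V`: the base point of the transversal is charted into the event and minimises with value `m`
    (hO0 : c.Φ (V, σ 0) ∈ Sf) (hmin : wilsonAction4 (c.Φ (V, σ 0)) = m) (ha0 : 0 < (c.jac (V, σ 0) : ℝ))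
    -- GAP♯ rows at `V`: growth to the orbit on the event
    {g : GaugeField (F.P K) 0 (Matrix.specialUnitaryGroup (Fin 2) ℂ) → ℝ} (hg : ContinuousOn g Xc) (hg0 : ∀ z ∈ Xc, 0 ≤ g z)
    (hgpos : ∀ z ∈ Xc, (∀ k, act k (σ 0) ≠ z) → 0 < g z)
    (hgrow : ∀ z ∈ Xc, c.Φ (V, z) ∈ Sf → m + g z ≤ wilsonAction4 (c.Φ (V, z)))
    -- the Peano row (transversal Hessian; seam GAP 2)
    {Ah : EuclideanSpace ℝ (Fin dV) →ₗ[ℝ] EuclideanSpace ℝ (Fin dV)} (hAs : Ah.IsSymmetric) (hpos : ∀ y, y ≠ 0 → 0 < ⟪Ah y, y⟫_ℝ)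
    (hS2 : (fun y => wilsonAction4 (c.Φ (V, σ y)) - wilsonAction4 (c.Φ (V, σ 0)) - (1 / 2) * ⟪Ah y, y⟫_ℝ) =o[𝓝 0] fun y => ‖y‖ ^ 2) :
    ∃ ℓ : ℝ, 0 < ℓ ∧
      Tendsto (fun lam : ℝ => lam ^ ((dV : ℝ) / 2) *
        (heightDensityCan F (γ / lam) hJK Sf V * Real.exp (lam * (F.scheme ℰp γ).β K * m))) atTop (𝓝 ℓ) := by
  classical
  haveI : CompactSpace S := hS
  -- `↥S` for a `Subgroup` is not syntactically a `Set`-subtype: supply the countability instances by hand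
  haveI : FirstCountableTopology S :=
    TopologicalSpace.Subtype.firstCountableTopology (S : Set (Site (F.P K) 0 → Matrix.specialUnitaryGroup (Fin 2) ℂ))
  haveI : SecondCountableTopology S :=
    TopologicalSpace.Subtype.secondCountableTopology (S : Set (Site (F.P K) 0 → Matrix.specialUnitaryGroup (Fin 2) ℂ))
  -- the model identity: KNIT §3 read as `e^{-b(A₀ - m)} · 1_{O₀} · a₀`
  have hmodel : ∀ lam : ℝ, 0 < lam →
      heightDensityCan F (γ / lam) hJK Sf V * Real.exp (lam * (F.scheme ℰp γ).β K * m) =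
        ∫ z, Real.exp (-(lam * (F.scheme ℰp γ).β K) * (wilsonAction4 (c.Φ (V, z)) - m)) *
          {z | c.Φ (V, z) ∈ Sf}.indicator (fun z => (c.jac (V, z) : ℝ)) z
          ∂fieldMeasure (F.P K) 0 (Matrix.specialUnitaryGroup (Fin 2) ℂ) := by
    intro lam hlam
    rw [heightDensityCan_mul_exp_eq_integral c hO hSf hγ.le hlam m hV]
    refine integral_congr_ae (Eventually.of_forall fun z => ?_)
    by_cases hz : c.Φ (V, z) ∈ Sf
    · have h1 : Sf.indicator (fun _ => (1 : ℝ)) (c.Φ (V, z)) = 1 := indicator_of_mem hz _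
      have h2 : {z | c.Φ (V, z) ∈ Sf}.indicator (fun z => (c.jac (V, z) : ℝ)) z = c.jac (V, z) := indicator_of_mem (by exact hz) _
      simp only [h1, h2, mul_one]; ring
    · have h1 : Sf.indicator (fun _ => (1 : ℝ)) (c.Φ (V, z)) = 0 := indicator_of_notMem hz _
      have h2 : {z | c.Φ (V, z) ∈ Sf}.indicator (fun z => (c.jac (V, z) : ℝ)) z = 0 := indicator_of_notMem (by exact hz) _
      simp only [h1, h2, mul_zero, zero_mul]
  have hlim := laplaceLimit_corner_on' (ν := ν) (κ := (volume : Measure (EuclideanSpace ℝ (Fin dZ))))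
    (X₀ := GaugeField (F.P K) 0 (Matrix.specialUnitaryGroup (Fin 2) ℂ)) (act₀ := act) (σ₀ := σ) (e := e)
    (Θ'₀ := fun p : EuclideanSpace ℝ (Fin dZ) × EuclideanSpace ℝ (Fin dV) => act (e p.1) (σ p.2)) (Sst := Sst)
    (μ₀ := fieldMeasure (F.P K) 0 (Matrix.specialUnitaryGroup (Fin 2) ℂ))
    F hγ hJK Sf m V hXc hXinv hvan hmodel hact hmul hone hpres hσ hσX he he1 he𝓝 (fun z y => rfl) hΘ'𝓝 hWo hinj hJc hJ0 hchart hρ hρW hstab hfix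
    hA ha hAinv hainv hOrel hOinv hO0 hmin hg hg0 hgpos hgrow hAs hpos hS2
  have hposc := laplaceLimit_corner_pos (ν := ν) (κ := (volume : Measure (EuclideanSpace ℝ (Fin dZ)))) F hγ K hact hmul hone hσ he1 he𝓝
    (fun z y => rfl) hΘ'𝓝 hWo hinj hρ hρW hstab hfix hAs hpos hJ00 (a := fun z => (c.jac (V, z) : ℝ)) ha0
  rw [finrank_euclideanSpace_fin] at hlim hposc
  exact ⟨_, hposc, hlim⟩

/-! ## §2 THE EXPLICIT EDITION (v2 append, for the DECAY door): the limit IS the Laplace–orbit constant, and that constant is positive -/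

/-- ★★★ **LIMIT-INST, EXPLICIT EDITION** — same rows as `laplaceLimit_of_charts`, but the limit is NAMED: `λ^{dV∕2} · (heightDensityCan F (γ∕λ) hJK Sf V · e^{λ β_K m})
→ (2π)^{dV∕2} · ν(Kg) · (∫_{ball ρ} Jd(z,0) dz ∕ ν((e(ball ρ)·Sst)⁻¹)) · jac_V(σ 0) ∕ √(det Ah) ∕ β_K^{dV∕2}` (the door ✓`…S2BetaLaplaceLimitOn.laplaceLimit_corner_on'`
read on the carrier of record (β″) with `κ := volume`, `finrank ℝ ℝ^{dV} = dV`).  This is the shape the DECAY door ✓`…S2BetaDecayDoor.abs_fourPt_log_oneLoopConst_le`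
consumes (`C x = ℓ x ∕ b`, `ℓ x = c₀ · P x ∕ √(D x)` with the DATUM-FREE `c₀ = (2π)^{dV∕2} · ν(Kg)`, `b = β_K^{dV∕2}`, `P x` = window constant × amplitude, `D x = det Ah_x`);
the existential edition above forgets it. [cite: Breitung1994, Thm 41 p. 56] [cite: Balaban1985Variational, Thm 1 (8)-(10) p. 279] [cite: Balaban1985UV3, (2) p. 256] -/
theorem laplaceLimit_of_charts_tendsto
    (F : T3Family) {γ : ℝ} (hγ : 0 < γ) {J K : ℕ} (hJK : J ≤ K)
    {Sf : Set (GaugeField (F.P K) 0 (Matrix.specialUnitaryGroup (Fin 2) ℂ))} (hSf : MeasurableSet Sf)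
    {O : Set (GaugeField (F.P J) 0 (Matrix.specialUnitaryGroup (Fin 2) ℂ))} (hO : IsOpen O)
    (c : WindowChart F hJK Sf O) {V : GaugeField (F.P J) 0 (Matrix.specialUnitaryGroup (Fin 2) ℂ)} (hV : V ∈ O) (m : ℝ)
    -- the group of record: a compact subgroup `S` (the residual gauge group) × the pivot translations, with a Haar measure
    (S : Subgroup (Site (F.P K) 0 → Matrix.specialUnitaryGroup (Fin 2) ℂ)) (hS : CompactSpace S)
    (ν : Measure (S × (PBond (F.P K) (K - J) → Matrix.specialUnitaryGroup (Fin 2) ℂ))) [ν.IsHaarMeasure]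
    -- the action of `Kg` on the fine fields (of record: px11's pivot-blind `pivotAct F hJK (iterCentralBond (K−J))`; only its four rows are used)
    (act : S × (PBond (F.P K) (K - J) → Matrix.specialUnitaryGroup (Fin 2) ℂ) →
      GaugeField (F.P K) 0 (Matrix.specialUnitaryGroup (Fin 2) ℂ) → GaugeField (F.P K) 0 (Matrix.specialUnitaryGroup (Fin 2) ℂ))
    (hact : Continuous fun p : (S × (PBond (F.P K) (K - J) → Matrix.specialUnitaryGroup (Fin 2) ℂ)) ×
      GaugeField (F.P K) 0 (Matrix.specialUnitaryGroup (Fin 2) ℂ) => act p.1 p.2)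
    (hmul : ∀ k k' z, act (k * k') z = act k (act k' z)) (hone : ∀ z, act 1 z = z)
    (hpres : ∀ k, MeasurePreserving (act k) (fieldMeasure (F.P K) 0 (Matrix.specialUnitaryGroup (Fin 2) ℂ))
      (fieldMeasure (F.P K) 0 (Matrix.specialUnitaryGroup (Fin 2) ℂ)))
    -- CHART∞ rows at `V` (w3-20520 g13): the compact invariant pivot-blind set carrying continuity, vanishing off it, invariances, relative openness
    {Xc : Set (GaugeField (F.P K) 0 (Matrix.specialUnitaryGroup (Fin 2) ℂ))} (hXc : IsCompact Xc) (hXinv : ∀ k z, z ∈ Xc → act k z ∈ Xc)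
    (hvan : ∀ z, z ∉ Xc → (c.jac (V, z) : ℝ) = 0)
    (hA : ContinuousOn (fun z => wilsonAction4 (c.Φ (V, z))) Xc) (ha : ContinuousOn (fun z => (c.jac (V, z) : ℝ)) Xc)
    (hAinv : ∀ k, ∀ z ∈ Xc, wilsonAction4 (c.Φ (V, act k z)) = wilsonAction4 (c.Φ (V, z)))
    (hainv : ∀ k, ∀ z ∈ Xc, (c.jac (V, act k z) : ℝ) = c.jac (V, z))
    (hOrel : IsOpen ((Subtype.val : Xc → GaugeField (F.P K) 0 (Matrix.specialUnitaryGroup (Fin 2) ℂ)) ⁻¹' {z | c.Φ (V, z) ∈ Sf}))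
    (hOinv : ∀ k, ∀ z ∈ Xc, c.Φ (V, z) ∈ Sf → c.Φ (V, act k z) ∈ Sf)
    -- (C3β″) rows (px21 g9): tubular Haar coordinates around the `act`-orbit of the minimiser, the transversal landing in `Xc`, the slice
    {dZ dV : ℕ} (e : EuclideanSpace ℝ (Fin dZ) → S × (PBond (F.P K) (K - J) → Matrix.specialUnitaryGroup (Fin 2) ℂ))
    (σ : EuclideanSpace ℝ (Fin dV) → GaugeField (F.P K) 0 (Matrix.specialUnitaryGroup (Fin 2) ℂ))
    (he : Continuous e) (he1 : e 0 = 1) (he𝓝 : 𝓝 (1 : S × (PBond (F.P K) (K - J) → Matrix.specialUnitaryGroup (Fin 2) ℂ)) ≤ map e (𝓝 0))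
    (hσ : Continuous σ) (hσX : ∀ y, σ y ∈ Xc)
    (hΘ'𝓝 : 𝓝 (σ 0) ≤ map (fun p : EuclideanSpace ℝ (Fin dZ) × EuclideanSpace ℝ (Fin dV) => act (e p.1) (σ p.2)) (𝓝 0))
    {W : Set (EuclideanSpace ℝ (Fin dZ) × EuclideanSpace ℝ (Fin dV))} (hWo : IsOpen W)
    (hinj : InjOn (fun p : EuclideanSpace ℝ (Fin dZ) × EuclideanSpace ℝ (Fin dV) => act (e p.1) (σ p.2)) W)
    {Jd : EuclideanSpace ℝ (Fin dZ) × EuclideanSpace ℝ (Fin dV) → ℝ} (hJc : ContinuousOn Jd W) (hJ0 : ∀ w ∈ W, 0 ≤ Jd w)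
    (hchart : (fieldMeasure (F.P K) 0 (Matrix.specialUnitaryGroup (Fin 2) ℂ)).restrict
        ((fun p : EuclideanSpace ℝ (Fin dZ) × EuclideanSpace ℝ (Fin dV) => act (e p.1) (σ p.2)) '' W) =
      ((((volume : Measure (EuclideanSpace ℝ (Fin dZ))).prod (volume : Measure (EuclideanSpace ℝ (Fin dV)))).restrict W).withDensity
          fun w => ENNReal.ofReal (Jd w)).map (fun p : EuclideanSpace ℝ (Fin dZ) × EuclideanSpace ℝ (Fin dV) => act (e p.1) (σ p.2)))
    {ρ : ℝ} (hρ : 0 < ρ) (hρW : closedBall (0 : EuclideanSpace ℝ (Fin dZ)) ρ ×ˢ {(0 : EuclideanSpace ℝ (Fin dV))} ⊆ W)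
    {Sst : Set (S × (PBond (F.P K) (K - J) → Matrix.specialUnitaryGroup (Fin 2) ℂ))}
    (hstab : ∀ k, act k (σ 0) = σ 0 → k ∈ Sst) (hfix : ∀ s ∈ Sst, ∀ y, act s (σ y) = σ y)
    -- EXW rows at `V`: the base point of the transversal is charted into the event and minimises with value `m`
    (hO0 : c.Φ (V, σ 0) ∈ Sf) (hmin : wilsonAction4 (c.Φ (V, σ 0)) = m)
    -- GAP♯ rows at `V`: growth to the orbit on the event
    {g : GaugeField (F.P K) 0 (Matrix.specialUnitaryGroup (Fin 2) ℂ) → ℝ} (hg : ContinuousOn g Xc) (hg0 : ∀ z ∈ Xc, 0 ≤ g z)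
    (hgpos : ∀ z ∈ Xc, (∀ k, act k (σ 0) ≠ z) → 0 < g z)
    (hgrow : ∀ z ∈ Xc, c.Φ (V, z) ∈ Sf → m + g z ≤ wilsonAction4 (c.Φ (V, z)))
    -- the Peano row (transversal Hessian; seam GAP 2)
    {Ah : EuclideanSpace ℝ (Fin dV) →ₗ[ℝ] EuclideanSpace ℝ (Fin dV)} (hAs : Ah.IsSymmetric) (hpos : ∀ y, y ≠ 0 → 0 < ⟪Ah y, y⟫_ℝ)
    (hS2 : (fun y => wilsonAction4 (c.Φ (V, σ y)) - wilsonAction4 (c.Φ (V, σ 0)) - (1 / 2) * ⟪Ah y, y⟫_ℝ) =o[𝓝 0] fun y => ‖y‖ ^ 2) :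
    Tendsto (fun lam : ℝ => lam ^ ((dV : ℝ) / 2) *
        (heightDensityCan F (γ / lam) hJK Sf V * Real.exp (lam * (F.scheme ℰp γ).β K * m))) atTop
      (𝓝 (((2 * π) ^ ((dV : ℝ) / 2) * (ν.real univ *
          ((∫ z in ball (0 : EuclideanSpace ℝ (Fin dZ)) ρ, Jd (z, 0)) /
              (ν (((e '' ball (0 : EuclideanSpace ℝ (Fin dZ)) ρ) * Sst)⁻¹)).toReal * (c.jac (V, σ 0) : ℝ) /
            Real.sqrt (LinearMap.det Ah)))) / ((F.scheme ℰp γ).β K) ^ ((dV : ℝ) / 2))) := by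
  classical
  haveI : CompactSpace S := hS
  -- `↥S` for a `Subgroup` is not syntactically a `Set`-subtype: supply the countability instances by hand
  haveI : FirstCountableTopology S :=
    TopologicalSpace.Subtype.firstCountableTopology (S : Set (Site (F.P K) 0 → Matrix.specialUnitaryGroup (Fin 2) ℂ))
  haveI : SecondCountableTopology S :=
    TopologicalSpace.Subtype.secondCountableTopology (S : Set (Site (F.P K) 0 → Matrix.specialUnitaryGroup (Fin 2) ℂ))
  -- the model identity: KNIT §3 read as `e^{-b(A₀ - m)} · 1_{O₀} · a₀`
  have hmodel : ∀ lam : ℝ, 0 < lam →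
      heightDensityCan F (γ / lam) hJK Sf V * Real.exp (lam * (F.scheme ℰp γ).β K * m) =
        ∫ z, Real.exp (-(lam * (F.scheme ℰp γ).β K) * (wilsonAction4 (c.Φ (V, z)) - m)) *
          {z | c.Φ (V, z) ∈ Sf}.indicator (fun z => (c.jac (V, z) : ℝ)) z
          ∂fieldMeasure (F.P K) 0 (Matrix.specialUnitaryGroup (Fin 2) ℂ) := by
    intro lam hlam
    rw [heightDensityCan_mul_exp_eq_integral c hO hSf hγ.le hlam m hV]
    refine integral_congr_ae (Eventually.of_forall fun z => ?_)
    by_cases hz : c.Φ (V, z) ∈ Sf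
    · have h1 : Sf.indicator (fun _ => (1 : ℝ)) (c.Φ (V, z)) = 1 := indicator_of_mem hz _
      have h2 : {z | c.Φ (V, z) ∈ Sf}.indicator (fun z => (c.jac (V, z) : ℝ)) z = c.jac (V, z) := indicator_of_mem (by exact hz) _
      simp only [h1, h2, mul_one]; ring
    · have h1 : Sf.indicator (fun _ => (1 : ℝ)) (c.Φ (V, z)) = 0 := indicator_of_notMem hz _
      have h2 : {z | c.Φ (V, z) ∈ Sf}.indicator (fun z => (c.jac (V, z) : ℝ)) z = 0 := indicator_of_notMem (by exact hz) _
      simp only [h1, h2, mul_zero, zero_mul]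
  have hlim := laplaceLimit_corner_on' (ν := ν) (κ := (volume : Measure (EuclideanSpace ℝ (Fin dZ))))
    (X₀ := GaugeField (F.P K) 0 (Matrix.specialUnitaryGroup (Fin 2) ℂ)) (act₀ := act) (σ₀ := σ) (e := e)
    (Θ'₀ := fun p : EuclideanSpace ℝ (Fin dZ) × EuclideanSpace ℝ (Fin dV) => act (e p.1) (σ p.2)) (Sst := Sst)
    (μ₀ := fieldMeasure (F.P K) 0 (Matrix.specialUnitaryGroup (Fin 2) ℂ))
    F hγ hJK Sf m V hXc hXinv hvan hmodel hact hmul hone hpres hσ hσX he he1 he𝓝 (fun z y => rfl) hΘ'𝓝 hWo hinj hJc hJ0 hchart hρ hρW hstab hfix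
    hA ha hAinv hainv hOrel hOinv hO0 hmin hg hg0 hgpos hgrow hAs hpos hS2
  rw [finrank_euclideanSpace_fin] at hlim
  exact hlim

/-- ★ **… AND THE NAMED CONSTANT IS POSITIVE** (the KNIT's `0 < C x` and the DECAY door's `0 < P x`-type inputs at the corner `V`), from the slice ∕ chart rows,
`0 < ∫_{ball ρ} Jd(z,0) dz` and `0 < jac_V(σ 0)` (✓`…S2BetaLaplaceLimit.laplaceLimit_corner_pos`). [cite: Breitung1994, Thm 41 p. 56] [cite: Balaban1985UV3, (2) p. 256] -/
theorem laplaceLimit_of_charts_const_pos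
    (F : T3Family) {γ : ℝ} (hγ : 0 < γ) {J K : ℕ} (hJK : J ≤ K)
    {Sf : Set (GaugeField (F.P K) 0 (Matrix.specialUnitaryGroup (Fin 2) ℂ))} {O : Set (GaugeField (F.P J) 0 (Matrix.specialUnitaryGroup (Fin 2) ℂ))}
    (c : WindowChart F hJK Sf O) (V : GaugeField (F.P J) 0 (Matrix.specialUnitaryGroup (Fin 2) ℂ))
    (S : Subgroup (Site (F.P K) 0 → Matrix.specialUnitaryGroup (Fin 2) ℂ)) (hS : CompactSpace S)
    (ν : Measure (S × (PBond (F.P K) (K - J) → Matrix.specialUnitaryGroup (Fin 2) ℂ))) [ν.IsHaarMeasure]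
    (act : S × (PBond (F.P K) (K - J) → Matrix.specialUnitaryGroup (Fin 2) ℂ) →
      GaugeField (F.P K) 0 (Matrix.specialUnitaryGroup (Fin 2) ℂ) → GaugeField (F.P K) 0 (Matrix.specialUnitaryGroup (Fin 2) ℂ))
    (hact : Continuous fun p : (S × (PBond (F.P K) (K - J) → Matrix.specialUnitaryGroup (Fin 2) ℂ)) ×
      GaugeField (F.P K) 0 (Matrix.specialUnitaryGroup (Fin 2) ℂ) => act p.1 p.2)
    (hmul : ∀ k k' z, act (k * k') z = act k (act k' z)) (hone : ∀ z, act 1 z = z)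
    {dZ dV : ℕ} (e : EuclideanSpace ℝ (Fin dZ) → S × (PBond (F.P K) (K - J) → Matrix.specialUnitaryGroup (Fin 2) ℂ))
    (σ : EuclideanSpace ℝ (Fin dV) → GaugeField (F.P K) 0 (Matrix.specialUnitaryGroup (Fin 2) ℂ))
    (he1 : e 0 = 1) (he𝓝 : 𝓝 (1 : S × (PBond (F.P K) (K - J) → Matrix.specialUnitaryGroup (Fin 2) ℂ)) ≤ map e (𝓝 0))
    (hσ : Continuous σ)
    (hΘ'𝓝 : 𝓝 (σ 0) ≤ map (fun p : EuclideanSpace ℝ (Fin dZ) × EuclideanSpace ℝ (Fin dV) => act (e p.1) (σ p.2)) (𝓝 0))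
    {W : Set (EuclideanSpace ℝ (Fin dZ) × EuclideanSpace ℝ (Fin dV))} (hWo : IsOpen W)
    (hinj : InjOn (fun p : EuclideanSpace ℝ (Fin dZ) × EuclideanSpace ℝ (Fin dV) => act (e p.1) (σ p.2)) W)
    {Jd : EuclideanSpace ℝ (Fin dZ) × EuclideanSpace ℝ (Fin dV) → ℝ}
    {ρ : ℝ} (hρ : 0 < ρ) (hρW : closedBall (0 : EuclideanSpace ℝ (Fin dZ)) ρ ×ˢ {(0 : EuclideanSpace ℝ (Fin dV))} ⊆ W)
    (hJ00 : 0 < ∫ z in ball (0 : EuclideanSpace ℝ (Fin dZ)) ρ, Jd (z, 0))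
    {Sst : Set (S × (PBond (F.P K) (K - J) → Matrix.specialUnitaryGroup (Fin 2) ℂ))}
    (hstab : ∀ k, act k (σ 0) = σ 0 → k ∈ Sst) (hfix : ∀ s ∈ Sst, ∀ y, act s (σ y) = σ y)
    (ha0 : 0 < (c.jac (V, σ 0) : ℝ))
    {Ah : EuclideanSpace ℝ (Fin dV) →ₗ[ℝ] EuclideanSpace ℝ (Fin dV)} (hAs : Ah.IsSymmetric) (hpos : ∀ y, y ≠ 0 → 0 < ⟪Ah y, y⟫_ℝ) :
    0 < ((2 * π) ^ ((dV : ℝ) / 2) * (ν.real univ *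
          ((∫ z in ball (0 : EuclideanSpace ℝ (Fin dZ)) ρ, Jd (z, 0)) /
              (ν (((e '' ball (0 : EuclideanSpace ℝ (Fin dZ)) ρ) * Sst)⁻¹)).toReal * (c.jac (V, σ 0) : ℝ) /
            Real.sqrt (LinearMap.det Ah)))) / ((F.scheme ℰp γ).β K) ^ ((dV : ℝ) / 2) := by
  haveI : CompactSpace S := hS
  haveI : FirstCountableTopology S :=
    TopologicalSpace.Subtype.firstCountableTopology (S : Set (Site (F.P K) 0 → Matrix.specialUnitaryGroup (Fin 2) ℂ))
  haveI : SecondCountableTopology S :=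
    TopologicalSpace.Subtype.secondCountableTopology (S : Set (Site (F.P K) 0 → Matrix.specialUnitaryGroup (Fin 2) ℂ))
  have hposc := laplaceLimit_corner_pos (ν := ν) (κ := (volume : Measure (EuclideanSpace ℝ (Fin dZ)))) F hγ K hact hmul hone hσ he1 he𝓝
    (fun z y => rfl) hΘ'𝓝 hWo hinj hρ hρW hstab hfix hAs hpos hJ00 (a := fun z => (c.jac (V, z) : ℝ)) ha0
  rw [finrank_euclideanSpace_fin] at hposc
  exact hposc

/-! ## §3 THE DENSITY ROW (v3 append): a radius with a positive slice integral -/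

/-- ★ **THE DENSITY ROW `hJ00`** — from the (C3β″) density rows (`J` continuous on the open window `W`, `J(0,0) > 0`, a closed-ball slice of radius `ρ₀`
inside `W`; ✓`…S2BetaTubularChartAct.exists_tubularHaarChart_act`) a radius `ρ ≤ ρ₀` with the slice still inside `W` (row `hρW`) AND a positive slice integral
`0 < ∫_{ball ρ} J(z,0) dz` (row `hJ00`): `J(·,0) > J(0,0)∕2` on a small ball, integrable on the compact closed ball. [cite: Breitung1994, Thm 41 p. 56]
[cite: Balaban1985Variational, Thm 1 (10) p.279] -/
theorem exists_radius_setIntegral_slice_pos {dZ dV : ℕ}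
    {W : Set (EuclideanSpace ℝ (Fin dZ) × EuclideanSpace ℝ (Fin dV))} (hWo : IsOpen W)
    {J : EuclideanSpace ℝ (Fin dZ) × EuclideanSpace ℝ (Fin dV) → ℝ} (hJc : ContinuousOn J W)
    (hJ00 : 0 < J (0, 0)) {ρ₀ : ℝ} (hρ₀ : 0 < ρ₀)
    (hρ₀W : closedBall (0 : EuclideanSpace ℝ (Fin dZ)) ρ₀ ×ˢ {(0 : EuclideanSpace ℝ (Fin dV))} ⊆ W) :
    ∃ ρ : ℝ, 0 < ρ ∧ closedBall (0 : EuclideanSpace ℝ (Fin dZ)) ρ ×ˢ {(0 : EuclideanSpace ℝ (Fin dV))} ⊆ W ∧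
      0 < ∫ z in ball (0 : EuclideanSpace ℝ (Fin dZ)) ρ, J (z, 0) := by
  -- the slice map `z ↦ (z, 0)` and continuity of `J ∘ slice` on the closed ball
  have h00W : ((0 : EuclideanSpace ℝ (Fin dZ)), (0 : EuclideanSpace ℝ (Fin dV))) ∈ W :=
    hρ₀W ⟨mem_closedBall_self hρ₀.le, rfl⟩
  have hsl : Continuous fun z : EuclideanSpace ℝ (Fin dZ) => (z, (0 : EuclideanSpace ℝ (Fin dV))) :=
    continuous_id.prodMk continuous_const
  have hJs : ContinuousOn (fun z : EuclideanSpace ℝ (Fin dZ) => J (z, 0)) (closedBall 0 ρ₀) :=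
    hJc.comp hsl.continuousOn fun z hz => hρ₀W ⟨hz, rfl⟩
  -- continuity at `0`: `J(z,0) > J(0,0)/2` on a small ball
  have hca : ContinuousAt (fun z : EuclideanSpace ℝ (Fin dZ) => J (z, 0)) 0 :=
    ContinuousAt.comp (g := J) (f := fun z : EuclideanSpace ℝ (Fin dZ) => (z, (0 : EuclideanSpace ℝ (Fin dV)))) (x := 0)
      (hJc.continuousAt (hWo.mem_nhds h00W)) hsl.continuousAt
  have hev : ∀ᶠ z in 𝓝 (0 : EuclideanSpace ℝ (Fin dZ)), J (0, 0) / 2 < J (z, 0) :=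
    hca.eventually (lt_mem_nhds (by linarith))
  obtain ⟨δ, hδ, hδball⟩ := Metric.eventually_nhds_iff_ball.mp hev
  refine ⟨min ρ₀ δ, lt_min hρ₀ hδ, ?_, ?_⟩
  · exact (Set.prod_mono (closedBall_subset_closedBall (min_le_left _ _)) Subset.rfl).trans hρ₀W
  · have hρ : 0 < min ρ₀ δ := lt_min hρ₀ hδ
    have hint : IntegrableOn (fun z : EuclideanSpace ℝ (Fin dZ) => J (z, 0)) (ball 0 (min ρ₀ δ)) volume :=
      ((hJs.mono (closedBall_subset_closedBall (min_le_left _ _))).integrableOn_compact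
        (isCompact_closedBall _ _)).mono_set ball_subset_closedBall
    have hle : ∫ z in ball (0 : EuclideanSpace ℝ (Fin dZ)) (min ρ₀ δ), J (0, 0) / 2 ≤
        ∫ z in ball (0 : EuclideanSpace ℝ (Fin dZ)) (min ρ₀ δ), J (z, 0) := by
      refine setIntegral_mono_on (integrableOn_const (by simp [measure_ball_lt_top.ne])) hint measurableSet_ball
        fun z hz => (hδball z (ball_subset_ball (min_le_right _ _) hz)).le
    refine lt_of_lt_of_le ?_ hle
    rw [setIntegral_const]
    refine mul_pos ?_ (by linarith)
    rw [Measure.real, ENNReal.toReal_pos_iff]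
    exact ⟨measure_ball_pos volume 0 hρ, measure_ball_lt_top⟩

end Summit.QuantumFields.YangMills.Theorems.FluctuationComparisonRegPrIntLS2BetaLaplaceInst

end
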